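import Summits.SmoothPoincare4.SmoothPoincare4.Theorems.DottedCircleRasmussenDcrGapHelperFriendsCarrierTkAux5
import Summits.SmoothPoincare4.SmoothPoincare4.Theorems.DottedCircleRasmussenDcrGapHelperFriendsCarrierTkAux1
import Summits.SmoothPoincare4.SmoothPoincare4.Theorems.DottedCircleRasmussenDcrGapHelperFriendsCarrierExterior

/-!
# Helper `helper_friendsCarrier_Tk_coreCharts` of stub `helper_friendsCarrier_Tk` — part 4: the compact core in the two charts
(item stmt-SmoothPoincare4-16128, route route-SmoothPoincare4-DottedCircleRasmussen)

Continuation of parts 1–3 (`…TkAux3–5`: the relative open trace `TraceDatum.Trace` of the model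
dotted handlebody `D_k`, its charts `incl`/`inr`, the core disc `coreDisc`).  The END of the trace is
the complement of the compact core `C = incl(D_k) ∪ coreDisc(𝔻²)`; this file describes `C` in the two
charts (the `k ≥ 1` analogue of `TubeNbhd.inr_mem_trCore_iff`, `inl_mem_core_iff`,
`eq_inl_or_eq_inr_zero` of the tree's `OpenTrace.lean`, and of `isCompact_coreC` of
`OpenTraceCollar.lean`), which is where the end collar `Y × ℝ ≅ T ∖ C` (the remaining part of
`helper_friendsCarrier_Tk`) starts:

* `TraceDatum.trCore`, `isCompact_trCore` — the core and its compactness;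
* `TraceDatum.inr_mem_trCore_iff` — `inr (x, w) ∈ C ↔ 1 ≤ ‖x‖ ∨ (w = 0 ∧ ‖x‖ ≤ 1)`;
* `TraceDatum.incl_mem_trCore_iff` — `incl y ∈ C ↔ y ∈ D_k ∨ y = θ(s, K₀ u)` with `0 ≤ s < δ` (the collar
  cylinder over the knot, i.e. the part of the core disc inside the `0`-handle chart);
* `TraceDatum.exists_of_not_mem_trCore` — a point off `C` is `incl y` with `y` in the open band
  `1 < G_k < 1 + δ` off the cylinder over the knot, or a cocore point `inr (0, w)`, `w ≠ 0`;
* `helper_friendsCarrier_Tk_coreCharts` — the registered summary.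

Everything is proved; no named facts, no `sorry`.
References: Kirby (1989), Ch. I §2 [Kirby1989]; Manolescu–Piccirillo (2023), §3.2 [ManolescuPiccirillo2023].
-/

-- the prescribed namespace `Summit.<P>.<Sub>.…` duplicates `SmoothPoincare4` (P = Sub)
set_option linter.dupNamespace false
set_option linter.style.longLine false

noncomputable section

open scoped Manifold ContDiff Topology
open Function Set Metric
open Literature.Topology.FourManifolds Literature.Topology.FourManifolds.MMSW

namespace Summit.SmoothPoincare4.SmoothPoincare4.Theorems.DcrGap.MkFriends

namespace FriendsTk

namespace TraceDatum

variable {k : ℕ} (D : TraceDatum k)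

/-! ### More on the radius/time exchange -/

/-- `0 ≤ s(r) ↔ r ≤ 1` (`r ≥ 0`). [folklore] -/
theorem collarTime_nonneg_iff {r : ℝ} (hr : 0 ≤ r) : 0 ≤ D.collarTime r ↔ r ≤ 1 := by
  have hδ := D.δ_pos
  have h1 : (0 : ℝ) < 1 + r := by linarith
  rw [collarTime, div_nonneg_iff]
  constructor
  · rintro (⟨h, -⟩ | ⟨-, h⟩)
    · by_contra hlt
      push Not at hlt
      have := mul_pos hδ (sub_pos.2 hlt)
      nlinarith
    · linarith
  · intro h; exact Or.inl ⟨by nlinarith, h1.le⟩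

/-- `E s ≤ 1` for `0 ≤ s < δ`. [folklore] -/
theorem handleRadius_le_one {s : ℝ} (h0 : 0 ≤ s) (hs : s < D.δ) : D.handleRadius s ≤ 1 := by
  rw [handleRadius, div_le_one (by linarith)]; linarith

/-! ### The compact core -/

/-- **The compact core** `C = incl(D_k) ∪ coreDisc(𝔻²)` of the relative open trace: the handlebody and
the core disc of the `2`-handle. [cite: Kirby1989, Ch. I §2] -/
def trCore : Set D.Trace := D.incl '' modelHandlebody k ∪ D.coreDisc '' closedBall (0 : EuclideanSpace ℝ (Fin 2)) 1

/-- The core is compact. [folklore] -/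
theorem isCompact_trCore : IsCompact D.trCore :=
  ((isCompact_modelHandlebody k).image_of_continuousOn
    (D.contMDiffOn_incl.continuousOn.mono D.modelHandlebody_subset_hbNbhd)).union
    ((isCompact_closedBall _ _).image D.contMDiff_coreDisc.continuous)

/-- The core is closed. [folklore] -/
theorem isClosed_trCore : IsClosed D.trCore := D.isCompact_trCore.isClosed

/-- **Points of the `2`-handle chart in the core**: `inr (x, w) ∈ C` iff `‖x‖ ≥ 1` (then it is `incl`
of a point of `D_k`, the collar time `δ(1 - ‖x‖)/(1 + ‖x‖)` being `≤ 0`) or `w = 0`, `‖x‖ ≤ 1` (the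
core disc). [folklore] -/
theorem inr_mem_trCore_iff {x w : EuclideanSpace ℝ (Fin 2)} :
    D.trGlueData.inr (x, w) ∈ D.trCore ↔ 1 ≤ ‖x‖ ∨ (w = 0 ∧ ‖x‖ ≤ 1) := by
  constructor
  · rintro (⟨y, hy, hxy⟩ | ⟨x', hx', hxx'⟩)
    · have hmem : D.trGlueData.inr (x, w) ∈ D.incl '' D.hbNbhd := ⟨y, D.modelHandlebody_subset_hbNbhd hy, hxy⟩
      rw [D.inr_mem_image_incl_iff] at hmem
      have hx0 : (x, w).1 ≠ 0 := hmem
      rw [D.inr_eq_incl_bwd hx0] at hxy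
      have hyeq : y = D.bwd (x, w) := D.injOn_incl (D.modelHandlebody_subset_hbNbhd hy) (D.bwd_mem_hbNbhd hx0) hxy
      have hpos : 0 < ‖x‖ := norm_pos_iff.2 hmem
      have hle : D.collarTime ‖x‖ ≤ 0 :=
        (D.mem_modelHandlebody_iff _ (D.νK_mem (radialProjection (spherePt 1) x, w)) _ (D.collarTime_mem_Ioo hpos)).1
          (by have : D.bwd (x, w) ∈ modelHandlebody k := hyeq ▸ hy; exact this)
      exact Or.inl ((D.collarTime_nonpos_iff hpos.le).1 hle)
    · rw [coreDisc_apply, D.trGlueData.inr_injective.eq_iff, Prod.mk.injEq] at hxx'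
      obtain ⟨rfl, rfl⟩ := hxx'
      rw [mem_closedBall, dist_zero_right] at hx'
      exact Or.inr ⟨rfl, hx'⟩
  · rintro (hx | ⟨rfl, hx⟩)
    · have hpos : 0 < ‖x‖ := by linarith
      have hx0 : (x, w).1 ≠ 0 := norm_pos_iff.1 hpos
      refine Or.inl ⟨D.bwd (x, w), ?_, (D.inr_eq_incl_bwd hx0).symm⟩
      exact (D.mem_modelHandlebody_iff _ (D.νK_mem (radialProjection (spherePt 1) x, w)) _ (D.collarTime_mem_Ioo hpos)).2
        ((D.collarTime_nonpos_iff hpos.le).2 hx)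
    · exact Or.inr ⟨x, by simpa using hx, rfl⟩

/-- **Points of the `0`-handle chart in the core**: for `y ∈ P`, `incl y ∈ C` iff `y ∈ D_k` or
`y = θ(s, K₀ u)` with `0 ≤ s < δ` (the collar cylinder over the knot `K₀ = ν(·, 0)`, which is the part of
the core disc inside the `0`-handle chart). [folklore] -/
theorem incl_mem_trCore_iff {y : EuclideanSpace ℝ (Fin 4)} (hy : y ∈ D.hbNbhd) :
    D.incl y ∈ D.trCore ↔ y ∈ modelHandlebody k ∨
      ∃ (u : Metric.sphere (0 : EuclideanSpace ℝ (Fin 2)) 1) (s : ℝ), 0 ≤ s ∧ s < D.δ ∧ y = D.θ (s, D.νK (u, 0)) := by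
  constructor
  · rintro (⟨y', hy', hyy'⟩ | ⟨x, hx, hxy⟩)
    · rw [D.injOn_incl (D.modelHandlebody_subset_hbNbhd hy') hy hyy'] at hy'
      exact Or.inl hy'
    · have hx0 : x ≠ 0 := by
        rintro rfl
        have : D.trGlueData.inr ((0 : EuclideanSpace ℝ (Fin 2)), (0 : EuclideanSpace ℝ (Fin 2))) ∈ D.incl '' D.hbNbhd :=
          ⟨y, hy, hxy.symm⟩
        rw [D.inr_mem_image_incl_iff] at this
        exact this rfl
      rw [D.coreDisc_eq_incl hx0] at hxy
      have hyeq : y = D.bwd (x, 0) := (D.injOn_incl (D.bwd_mem_hbNbhd (p := (x, 0)) hx0) hy hxy).symm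
      have hpos : 0 < ‖x‖ := norm_pos_iff.2 hx0
      rw [mem_closedBall, dist_zero_right] at hx
      refine Or.inr ⟨radialProjection (spherePt 1) x, D.collarTime ‖x‖, (D.collarTime_nonneg_iff hpos.le).2 hx,
        (D.collarTime_mem_Ioo hpos).2, ?_⟩
      rw [hyeq]
      conv_lhs => rw [← norm_smul_coe_radialProjection (spherePt 1) x]
      exact D.bwd_smul hpos _ _
  · rintro (hy' | ⟨u, s, hs0, hsδ, rfl⟩)
    · exact Or.inl ⟨y, hy', rfl⟩
    · have hs : s ∈ Ioo (-D.δ) D.δ := ⟨by linarith [D.δ_pos], hsδ⟩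
      have hr := D.handleRadius_pos hs
      refine Or.inr ⟨D.handleRadius s • (u : EuclideanSpace ℝ (Fin 2)), ?_, ?_⟩
      · rw [mem_closedBall, dist_zero_right, norm_smul_coe_sphere hr.le]
        exact D.handleRadius_le_one hs0 hsδ
      · rw [D.coreDisc_eq_incl (smul_ne_zero hr.ne' (ne_zero_of_mem_unit_sphere u)), D.bwd_smul hr,
          D.collarTime_handleRadius hs]

/-- A cocore point `inr (0, w)` lies in the core iff `w = 0` (the centre of the core disc). [folklore] -/
theorem inr_zero_mem_trCore_iff {w : EuclideanSpace ℝ (Fin 2)} :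
    D.trGlueData.inr (0, w) ∈ D.trCore ↔ w = 0 := by
  rw [D.inr_mem_trCore_iff]; simp

/-! ### Points off the core -/

/-- The drop `θ(1 - G_k y, y)` of a band point lies on `M_k`, and `y = θ(G_k y - 1, drop y)`. [folklore] -/
theorem drop_mem_modelBoundary {y : EuclideanSpace ℝ (Fin 4)} (hg : ∀ j, (1 : ℝ) / 2 < holeTerm k j y)
    (hG : levelFun k y ∈ Ioo (1 - D.δ) (1 + D.δ)) :
    D.θ (1 - levelFun k y, y) ∈ modelBoundary k ∧ D.θ (levelFun k y - 1, D.θ (1 - levelFun k y, y)) = y := by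
  have ht : levelFun k y + (1 - levelFun k y) ∈ Ioo (1 - D.δ) (1 + D.δ) := by
    rw [add_sub_cancel]; exact ⟨by linarith [D.δ_pos], by linarith [D.δ_pos]⟩
  obtain ⟨hg', hG'⟩ := D.clock y hg hG _ ht
  rw [add_sub_cancel] at hG'
  refine ⟨⟨fun j => one_le_holeTerm_of_levelFun_le_one (fun j => lt_trans (by norm_num) (hg' j)) hG'.le j, hG'⟩, ?_⟩
  rw [D.θ_add, show levelFun k y - 1 + (1 - levelFun k y) = 0 by ring, D.θ_zero]

/-- **Points off the core in the two charts**: a point of the trace off `C` is `incl y` with `y` in the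
open band `1 < G_k < 1 + δ` of `P` and off the collar cylinder over the knot, or a cocore point
`inr (0, w)` with `w ≠ 0`. [folklore] -/
theorem exists_of_not_mem_trCore {z : D.Trace} (hz : z ∉ D.trCore) :
    (∃ y ∈ D.hbNbhd, 1 < levelFun k y ∧
      (∀ (u : Metric.sphere (0 : EuclideanSpace ℝ (Fin 2)) 1) (s : ℝ), 0 ≤ s → s < D.δ → y ≠ D.θ (s, D.νK (u, 0))) ∧
      D.incl y = z) ∨ ∃ w : EuclideanSpace ℝ (Fin 2), w ≠ 0 ∧ D.trGlueData.inr (0, w) = z := by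
  obtain (⟨y, hy, rfl⟩ | ⟨w, rfl⟩) := D.eq_incl_or_eq_inr_zero z
  · left
    have h := mt (D.incl_mem_trCore_iff hy).2 hz
    push Not at h
    exact ⟨y, hy, FriendsH2.one_lt_levelFun_of_not_mem (fun j => lt_trans (by norm_num) (hy.1 j)) h.1,
      fun u s hs0 hsδ => h.2 u s hs0 hsδ, rfl⟩
  · right
    exact ⟨w, fun hw => hz (D.inr_zero_mem_trCore_iff.2 hw), rfl⟩

end TraceDatum

end FriendsTk

/-- **Helper `helper_friendsCarrier_Tk_coreCharts`** (registered on the crux item; piece (3d) of the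
relative open trace `T_k` of stub `helper_friendsCarrier_Tk`): the compact core
`C = i(D_k) ∪ f₀(𝔻²)` of the relative open trace seen from the two charts — `h (x, w) ∈ C` iff
`‖x‖ ≥ 1` or `w = 0, ‖x‖ ≤ 1`; `i y ∈ C` (`y ∈ P`) iff `y ∈ D_k` or `y = θ(s, K₀ u)`, `0 ≤ s < δ`; and a
point off `C` is `i y` with `y` in the open band off the cylinder over the knot, or a cocore point
`h (0, w)`, `w ≠ 0` — the two pieces from which the end collar `Y × ℝ ≅ T ∖ C` is assembled
(Kirby 1989, Ch. I §2 / §5). [cite: Kirby1989, Ch. I §2] -/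
theorem helper_friendsCarrier_Tk_coreCharts : ∀ (k : ℕ) (νK : (sphere (0 : EuclideanSpace ℝ (Fin 2)) 1) × EuclideanSpace ℝ (Fin 2) → EuclideanSpace ℝ (Fin 4)) (θ : ℝ × EuclideanSpace ℝ (Fin 4) → EuclideanSpace ℝ (Fin 4)) (δ : ℝ) (ι : EuclideanSpace ℝ (Fin 4) → (sphere (0 : EuclideanSpace ℝ (Fin 2)) 1) × EuclideanSpace ℝ (Fin 2)), 0 < δ → δ < 1 → ContDiff ℝ ((⊤ : ℕ∞) : WithTop ℕ∞) θ → (∀ x, θ (0, x) = x) → (∀ t s x, θ (t, θ (s, x)) = θ (t + s, x)) → (∀ y : EuclideanSpace ℝ (Fin 4), (∀ j, (1 : ℝ) / 2 < holeTerm k j y) → levelFun k y ∈ Ioo (1 - δ) (1 + δ) → ∀ t : ℝ, levelFun k y + t ∈ Ioo (1 - δ) (1 + δ) → (∀ j, (1 : ℝ) / 2 < holeTerm k j (θ (t, y))) ∧ levelFun k (θ (t, y)) = levelFun k y + t) → (∀ a ∈ modelBoundary k, ∀ s ∈ Ioo (-δ) δ, (θ (s, a) ∈ modelHandlebody k ↔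 s ≤ 0)) → ContMDiff ((𝓡 1).prod 𝓘(ℝ, EuclideanSpace ℝ (Fin 2))) 𝓘(ℝ, EuclideanSpace ℝ (Fin 4)) ((⊤ : ℕ∞) : WithTop ℕ∞) νK → (∀ p, νK p ∈ modelBoundary k) → IsOpen {y : EuclideanSpace ℝ (Fin 4) | (∀ j, (1 : ℝ) / 2 < holeTerm k j y) ∧ levelFun k y ∈ Ioo (1 - δ) (1 + δ) ∧ θ (1 - levelFun k y, y) ∈ range νK} → ContMDiffOn 𝓘(ℝ, EuclideanSpace ℝ (Fin 4)) ((𝓡 1).prod 𝓘(ℝ, EuclideanSpace ℝ (Fin 2))) ((⊤ : ℕ∞) : WithTop ℕ∞) ι {y : EuclideanSpace ℝ (Fin 4) | (∀ j, (1 : ℝ) / 2 < holeTerm k j y) ∧ levelFun k y ∈ Ioo (1 - δ) (1 + δ) ∧ θ (1 - levelFun k y, y) ∈ range νK} → (∀ (q : (sphere (0 : EuclideanSpace ℝ (Fin 2)) 1) × EuclideanSpace ℝ (Fin 2)) (s : ℝ), s ∈ Ioo (-δ) δ → ι (θ (s, νK q)) = q) → (∀ y ∈ {y : EuclideanSpace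 ℝ (Fin 4) | (∀ j, (1 : ℝ) / 2 < holeTerm k j y) ∧ levelFun k y ∈ Ioo (1 - δ) (1 + δ) ∧ θ (1 - levelFun k y, y) ∈ range νK}, θ (levelFun k y - 1, νK (ι y)) = y) → ∃ (X : Type) (_ : TopologicalSpace X) (_ : T2Space X) (_ : ChartedSpace (EuclideanSpace ℝ (Fin 4)) X) (_ : IsManifold (𝓡 4) ((⊤ : ℕ∞) : WithTop ℕ∞) X) (i : EuclideanSpace ℝ (Fin 4) → X) (h : EuclideanSpace ℝ (Fin 2) × EuclideanSpace ℝ (Fin 2) → X) (f₀ : EuclideanSpace ℝ (Fin 2) → X), (∀ x, f₀ x = h (x, 0)) ∧ ContMDiffOn (𝓡 4) (𝓡 4) ((⊤ : ℕ∞) : WithTop ℕ∞) i {y : EuclideanSpace ℝ (Fin 4) | (∀ j, (1 : ℝ) / 2 < holeTerm k j y) ∧ levelFun k y < 1 + δ} ∧ ContMDiff 𝓘(ℝ, EuclideanSpace ℝ (Fin 2) × EuclideanSpace ℝ (Fin 2)) (𝓡 4) ((⊤ : ℕ∞) : WithTop ℕ∞) h ∧ (∀ y ∈ {y : EuclideanSpace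 ℝ (Fin 4) | (∀ j, (1 : ℝ) / 2 < holeTerm k j y) ∧ levelFun k y < 1 + δ}, ∀ p : EuclideanSpace ℝ (Fin 2) × EuclideanSpace ℝ (Fin 2), i y = h p ↔ p.1 ≠ 0 ∧ θ (δ * (1 - ‖p.1‖) / (1 + ‖p.1‖), νK (radialProjection (spherePt 1) p.1, p.2)) = y) ∧ IsCompact (i '' modelHandlebody k ∪ f₀ '' closedBall (0 : EuclideanSpace ℝ (Fin 2)) 1) ∧ (∀ p : EuclideanSpace ℝ (Fin 2) × EuclideanSpace ℝ (Fin 2), h p ∈ (i '' modelHandlebody k ∪ f₀ '' closedBall (0 : EuclideanSpace ℝ (Fin 2)) 1) ↔ 1 ≤ ‖p.1‖ ∨ (p.2 = 0 ∧ ‖p.1‖ ≤ 1)) ∧ (∀ y ∈ {y : EuclideanSpace ℝ (Fin 4) | (∀ j, (1 : ℝ) / 2 < holeTerm k j y) ∧ levelFun k y < 1 + δ}, i y ∈ (i '' modelHandlebody k ∪ f₀ '' closedBall (0 : EuclideanSpace ℝ (Fin 2)) 1) ↔ y ∈ modelHandlebody k ∨ ∃ (u : (sphere (0 : EuclideanSpace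 ℝ (Fin 2)) 1)) (s : ℝ), 0 ≤ s ∧ s < δ ∧ y = θ (s, νK (u, 0))) ∧ (∀ z : X, z ∉ (i '' modelHandlebody k ∪ f₀ '' closedBall (0 : EuclideanSpace ℝ (Fin 2)) 1) → (∃ y ∈ {y : EuclideanSpace ℝ (Fin 4) | (∀ j, (1 : ℝ) / 2 < holeTerm k j y) ∧ levelFun k y < 1 + δ}, 1 < levelFun k y ∧ (∀ (u : (sphere (0 : EuclideanSpace ℝ (Fin 2)) 1)) (s : ℝ), 0 ≤ s → s < δ → y ≠ θ (s, νK (u, 0))) ∧ i y = z) ∨ ∃ w : EuclideanSpace ℝ (Fin 2), w ≠ 0 ∧ h (0, w) = z) := by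
  intro k νK θ δ ι hδ hδ1 hθ h0 hadd hclock hiff hν hmem hopen hι hιθ hθι
  let D : FriendsTk.TraceDatum k := ⟨νK, θ, δ, ι, hδ, hδ1, hθ, h0, hadd, hclock, hiff, hν, hmem, hopen, hι, hιθ, hθι⟩
  refine ⟨D.Trace, inferInstance, inferInstance, inferInstance, inferInstance, D.incl, D.trGlueData.inr, D.coreDisc,
    fun x => rfl, D.contMDiffOn_incl, D.trGlueData.contMDiff_inr, fun y hy p => D.incl_eq_inr_iff hy,
    D.isCompact_trCore, fun p => D.inr_mem_trCore_iff, fun y hy => D.incl_mem_trCore_iff hy, fun z hz => ?_⟩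
  rcases D.exists_of_not_mem_trCore hz with ⟨y, hy, h1, h2, h3⟩ | ⟨w, hw, h3⟩
  · exact Or.inl ⟨y, hy, h1, h2, h3⟩
  · exact Or.inr ⟨w, hw, h3⟩

end Summit.SmoothPoincare4.SmoothPoincare4.Theorems.DcrGap.MkFriends

end
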